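import Summits.QuantumFields.BalabanUV.Beta.D1BFx.SymBmAbsorbsBm
import Summits.QuantumFields.BalabanUV.Beta.CombOneShotJets
import Summits.QuantumFields.BalabanUV.Beta.CombOneShotJetsTabs
import Summits.QuantumFields.BalabanUV.Beta.AxialDressingRootedBmHessian
import Summits.QuantumFields.BalabanUV.Beta.RelInvBorderedHessian

/-!
# Road «BF-x» — (J1) AT THE LITERAL OF RECORD, EXACT: **the typed one-shot kernel of the chart-(III′) literal `JsB12CombShSym … 0` at blocking `n` IS the road's
# Π_bm-legged Hessian kernel `hessKer (G₀^{bm} r) (vertexOfK (G₀^{bm} r) n S) W` with `S, W` the DRESSED literal's OWN jets — for EVERY in-block root `r`**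
# (unit `b2b-balaban-beta-d1-p2`, gen 21 — road OWNER; «(J1-γ) ABSORPTION», answering an2 g42 R-D1-g42-1 (a) and the owner's Q-g21-1)

HONEST DEPENDENCY (page 1, mandatory): continuum YM on T⁴ ⇐ BetaPertH ∧ nine spine estimates (0/9 proved); BetaPertH ⇐ (D1) ∧ (D4) ∧ CAP+tail;
G-an2-4 gates asym, D1 and NE2/3/4.  HONEST FRAMING (cell contract, verbatim): «discharging `BetaPertH` makes Bałaban's UV stability UNCONDITIONAL — a real
constructive-QFT result; it is NOT the continuum limit and NOT the Clay problem.»  THIS FILE: [folklore] kernel bookkeeping BY NAME over an2's dressing lemmas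
(`hessKer_dressSymAt`, `hessKer_dressAt`) and the owner's absorption `SymBmAbsorbsBm.coDressKSymAt_coDressKBmAt`; nothing of Bałaban's asserted; it identifies
the (J1) junction's TWO SIDES as kernels — it does NOT discharge the road's sockets on `S := (JsB12CombShSym … 0).S` nor the (L0) letters, NOR the second-order slot's
shape (the road reads `vertex2OfK G₀ n S₂`, the literal's `W` is the four-word `W2SymOfK` — R-D1-g42-1 (b); PART 20's rest carries the difference); 0 root-level binders
of row D1 discharged; (K) NOT closed; NOT D1, NOT BetaPertH, NOT continuum, NOT Clay.

WHY ∕ WHAT.  an2 g42 R-D1-g42-1 (a): the literal's leg `GcombSh n 0 = coDressKAt ρc (coDressKSymAt ρc (KInvStep n 0))` and the road's `G₀^{bm} r = coDressKBmAt (toSite r) n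
(KInvStep n 0)` DIFFER as kernels (Engine C's CHART row).  But for ANY spread kernel `K`, an2's dressing lemmas give
`hessKer K (vertexOfK K n (JsB12CombShSym … 0).S) (JsB12CombShSym … 0).W = hessKer (coDressKAt ρc (coDressKSymAt ρc K)) (vertexOfK … (JsB12CombSh0 … 0).S) (JsB12CombSh0 … 0).W`
(§1 `hessKer_JsB12CombShSym_of_decays`), and the owner's absorption `Π̂^{sym}_bm ∘ Π_bm = Π̂^{sym}_bm` gives `coDressKSymAt ρc (G₀^{bm} r) = coDressKSymAt ρc (KInvStep n 0)`;
reading §1 once at `K := KInvStep n 0` (the typed kernel `TOf`, via `vertexOfK_KInv` + `KInvStep_zero_eq`) and once at `K := G₀^{bm} r` yields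
§2 **`TOf_JsB12CombShSym_zero_eq_hessKer_bm (hr : r ∈ box 4 n) : TOf (JsB12CombShSym hodd N tabs cΛ cB 0) = hessKer (G₀^{bm} r) (vertexOfK (G₀^{bm} r) n (JsB12CombShSym … 0).S)
(JsB12CombShSym … 0).W`** — (J1) EXACT at the road's Π_bm leg, with the DRESSED literal's jets in the road's `S`-slot.  At an2's `CombOneShotJets.JcOf hLc N cΛ cB m :=
JsB12CombShSym (Lc := Lc^m) … 0` this reads `TshotOf Lc JcOf m = hessKer (G₀^{bm} (r (Lc^m))) (vertexOfK … ((JcOf m).S)) ((JcOf m).W)` — §3 `TshotOf_JcOf_eq_hessKer_bm` (an2's `CombOneShotJets` p339189 ✓).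
CONSEQUENCE for the route question (R-D1-g42-1): neither (J1-α) RE-LEG nor the (J1-β) invariance row is needed for the LEG — the road keeps `Π_bm` and reads the literal's
dressed jets; what remains of (J1) is (b) (the `W`-slot's three extra words → PART 20's rest `RJ1` = their tadpoles) and the road's SOCKETS ∕ letters on that `S`.
ABSOLUTE RULE (cell charter, verbatim): «No internally-minted statement may enter as a cited fact. Every hypothesis is either kernel-proved in this package or a
verbatim quotation of a PUBLISHED theorem with page reference. The manuscript(s) under audit are NOT citable for their own disputed steps — they are the thing
under adjudication; programme-internal (2001/route/tribunal) claims are never citable.»  No `def`, no `def … : Prop`, nothing cited; 0 sorry.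
-/

noncomputable section

namespace Summit.QuantumFields.BalabanUV.Beta.D1BFx.RoadJ1Absorption

open Literature.MathematicalPhysics.QuantumFieldTheory
open Literature.MathematicalPhysics.QuantumFieldTheory.Balaban1983to89
open Literature.MathematicalPhysics.QuantumFieldTheory.Balaban1983to89.Beta
open ExpKernelCalculus (MKer Decays hessKer)
open AffineAveraging (box toSite)
open AveragingContoursRooted (ctr ctrOff ctrOff_mem_box)
open OneStepResolventKernel (Fib JetData KInv TOf vertexOf)
open OneStepKernelFamily (KInvStep vertexOfK decays_KInvStep vertexOfK_KInv)
open Summit.QuantumFields.BalabanUV.Beta.TameKernelCalculus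
open Summit.QuantumFields.BalabanUV.Beta.AxialDressingRooted (one_le_of_neZero dressAt coDressKAt hessKer_dressAt coDressKBmAt decays_coDressKBmAt_KInvStep)
open Summit.QuantumFields.BalabanUV.Beta.SymmetrisedDressingKernel (coDressKSymAt decays_coDressKSymAt)
open Summit.QuantumFields.BalabanUV.Beta.SymmetrisedDressingDress (dressSymAt)
open Summit.QuantumFields.BalabanUV.Beta.SymmetrisedDressingHessian (hessKer_dressSymAt)
open Summit.QuantumFields.BalabanUV.Beta.SymmetrisedStepJets (SymTables)
open Summit.QuantumFields.BalabanUV.Beta.CombChartStepJets (GcombSh JsB12CombSh0)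
open Summit.QuantumFields.BalabanUV.Beta.CombChartJointEnd (JsB12CombShSym JsB12CombShSym_eq)
open Summit.QuantumFields.BalabanUV.Beta.BorderedHessian (KInvStep_zero_eq)
open Summit.QuantumFields.BalabanUV.Beta.D1BFx.SymBmAbsorbsBm (coDressKSymAt_coDressKBmAt)
open Summit.QuantumFields.BalabanUV.Beta.CombOneShotJets (JcOf JcOf_apply)
open Summit.QuantumFields.BalabanUV.Beta.CombOneShotJetsTabs (JcOfTabs JcOfTabs_apply)
open Summit.QuantumFields.BalabanUV.Beta.SymSecondOrderTablesAn1 (symTablesAn1S2)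
open OneStepKernelFamily (TshotOf)

variable (n : ℕ) [NeZero n] (hodd : Odd n) (N : ℕ) (tabs : SymTables 3 n) (cΛ cB : ℝ)

/-! ## §1 The doubly-dressed literal against an ARBITRARY spread kernel -/

/-- [folklore] **THE (III′) LITERAL's LEVEL-0 HESSIAN AGAINST ANY SPREAD KERNEL `K`**: `hessKer K (vertexOfK K n (JsB12CombShSym … 0).S) (JsB12CombShSym … 0).W
= hessKer (coDressKAt ρc n (coDressKSymAt ρc n K)) (vertexOfK … n (JsB12CombSh0 … 0).S) (JsB12CombSh0 … 0).W` (an2's `hessKer_dressSymAt` then `hessKer_dressAt`). -/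
theorem hessKer_JsB12CombShSym_of_decays {K : MKer 4 (Fib 3)} (hK : ∃ δ C : ℝ, 0 < δ ∧ 0 ≤ C ∧ Decays K C δ) :
    hessKer K (vertexOfK K n (JsB12CombShSym hodd N tabs cΛ cB 0).S) (JsB12CombShSym hodd N tabs cΛ cB 0).W =
      hessKer (coDressKAt (ctr 4 n) n (coDressKSymAt (ctr 4 n) n K))
        (vertexOfK (coDressKAt (ctr 4 n) n (coDressKSymAt (ctr 4 n) n K)) n (JsB12CombSh0 hodd N tabs cΛ cB 0).S)
        (JsB12CombSh0 hodd N tabs cΛ cB 0).W := by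
  rw [JsB12CombShSym_eq, hessKer_dressSymAt (ctrOff_mem_box (d := 4) (one_le_of_neZero n)) hK,
    hessKer_dressAt (ctrOff_mem_box (d := 4) (one_le_of_neZero n)) (decays_coDressKSymAt (one_le_of_neZero n) (ctrOff_mem_box (d := 4) (one_le_of_neZero n)) hK)]
  rfl

/-! ## §2 (J1) EXACT at the road's Π_bm leg -/

/-- [folklore] **(J1) AT THE LITERAL OF RECORD, EXACT, AT THE ROAD's Π_bm LEG — ANY IN-BLOCK ROOT `r`.**
`TOf (JsB12CombShSym hodd N tabs cΛ cB 0) = hessKer (G₀^{bm} r) (vertexOfK (G₀^{bm} r) n (JsB12CombShSym … 0).S) (JsB12CombShSym … 0).W`,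
`G₀^{bm} r := coDressKBmAt (toSite r) n (KInvStep n 0)`: the spine's one-shot kernel of the chart-(III′) literal IS the road's Hessian kernel at its own leg, with the
DRESSED literal's jets in the `S`- and `W`-slots — §1 at `K := KInvStep n 0` and at `K := G₀^{bm} r`, glued by the absorption `coDressKSymAt ρc (G₀^{bm} r) = coDressKSymAt ρc (KInvStep n 0)`. -/
theorem TOf_JsB12CombShSym_zero_eq_hessKer_bm {r : Fin 4 → ℕ} (hr : r ∈ box (3 + 1) n) :
    TOf (N := n) (JsB12CombShSym hodd N tabs cΛ cB 0) =
      hessKer (coDressKBmAt (toSite r) n (KInvStep (d := 3) n 0))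
        (vertexOfK (coDressKBmAt (toSite r) n (KInvStep (d := 3) n 0)) n (JsB12CombShSym hodd N tabs cΛ cB 0).S)
        (JsB12CombShSym hodd N tabs cΛ cB 0).W := by
  have hN : 1 ≤ n := one_le_of_neZero n
  have hK₀ : ∃ δ C : ℝ, 0 < δ ∧ 0 ≤ C ∧ Decays (KInvStep (d := 3) n 0) C δ := decays_KInvStep (d := 3) (Lc := n) 0
  have hspr : Spr (KInvStep (d := 3) n 0) := by
    obtain ⟨δ, C, hδ, -, h⟩ := hK₀
    exact ⟨C, δ, hδ, h⟩
  -- §1 at the road's leg, absorbed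
  have h2 := hessKer_JsB12CombShSym_of_decays n hodd N tabs cΛ cB (decays_coDressKBmAt_KInvStep (d := 3) hr 0)
  rw [show ctr 4 n = toSite (ctrOff 4 n) from rfl, coDressKSymAt_coDressKBmAt hN hr (ctrOff_mem_box (d := 4) hN) hspr] at h2
  -- §1 at the typed kernel's leg
  have h1 := hessKer_JsB12CombShSym_of_decays n hodd N tabs cΛ cB hK₀
  rw [show ctr 4 n = toSite (ctrOff 4 n) from rfl] at h1
  -- the typed kernel: `TOf J = hessKer KInv (vertexOf J.S) J.W`, `vertexOf = vertexOfK KInv n`, `KInv = KInvStep n 0`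
  have hv : vertexOf (N := n) (JsB12CombShSym hodd N tabs cΛ cB 0).S = vertexOfK (KInvStep (d := 3) n 0) n (JsB12CombShSym hodd N tabs cΛ cB 0).S := by
    funext μ' y
    rw [KInvStep_zero_eq, vertexOfK_KInv]
  have hKI : (KInv (N := n) (d := 3)) = KInvStep (d := 3) n 0 := KInvStep_zero_eq.symm
  show hessKer (KInv (N := n) (d := 3)) (vertexOf (N := n) (JsB12CombShSym hodd N tabs cΛ cB 0).S) (JsB12CombShSym hodd N tabs cΛ cB 0).W = _
  rw [hv, hKI, h1, ← h2]

/-! ## §3 At the one-shot literal of record `JcOf` (an2 g42, `CombOneShotJets` p339189) -/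

/-- [folklore] **(J1) AT `JcOf`, EXACT — EVERY SCALE `m`, EVERY IN-BLOCK ROOT**: `TshotOf Lc (JcOf hLc N cΛ cB) m = hessKer (G₀^{bm} r) (vertexOfK (G₀^{bm} r) (Lc^m) (JcOf … m).S)
(JcOf … m).W`, `G₀^{bm} r := coDressKBmAt (toSite r) (Lc^m) (KInvStep (Lc^m) 0)` — §2 at blocking `Lc^m` (`JcOf_apply` is `rfl`). This is road «BF-x»'s (J1) binder
(PART 10 … PART 21) at `Jc := JcOf`, `S n := (JcOf … m).S`, up to the second-order slot's shape (R-D1-g42-1 (b), PART 20's rest). -/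
theorem TshotOf_JcOf_eq_hessKer_bm {Lc : ℕ} [NeZero Lc] (hLc : Odd Lc) (N : ℕ) (cΛ cB : ℕ → ℝ) (m : ℕ) {r : Fin 4 → ℕ}
    (hr : r ∈ box (3 + 1) (Lc ^ m)) :
    TshotOf Lc (JcOf hLc N cΛ cB) m =
      hessKer (coDressKBmAt (toSite r) (Lc ^ m) (KInvStep (d := 3) (Lc ^ m) 0))
        (vertexOfK (coDressKBmAt (toSite r) (Lc ^ m) (KInvStep (d := 3) (Lc ^ m) 0)) (Lc ^ m) (JcOf hLc N cΛ cB m).S)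
        (JcOf hLc N cΛ cB m).W := by
  show TOf (N := Lc ^ m) (JcOf hLc N cΛ cB m) = _
  rw [JcOf_apply]
  exact TOf_JsB12CombShSym_zero_eq_hessKer_bm (Lc ^ m) hLc.pow N (symTablesAn1S2 3 (Lc ^ m) (cΛ m)) (cΛ m) (cB m) hr

/-- [folklore] **THE (γ) ANCHOR AT THE LITERAL OF RECORD `JcComp := JcOfTabs tabsComp`** (an2 RULING R-D1-g42-4 (3), Engine C R-FP-22-DET1 (Q) = (c); an2 g43's
`CombOneShotJetsTabs.JcOfTabs`, p344288): for ANY table record `tabs : ∀ m, SymTables 3 (Lc^m)` and every in-block road root `r`,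
`TshotOf Lc (JcOfTabs hLc N tabs cΛ cB) m = hessKer (G₀^{bm} r) (vertexOfK (G₀^{bm} r) (Lc^m) (JcOfTabs … m).S) (JcOfTabs … m).W` — §2 at the record's tables
(v1.1 append, owner d1-p2 gen 22; `TshotOf_JcOf_eq_hessKer_bm` is the case `tabs m := symTablesAn1S2 3 (Lc^m) (cΛ m)`). -/
theorem TshotOf_JcOfTabs_eq_hessKer_bm {Lc : ℕ} [NeZero Lc] (hLc : Odd Lc) (N : ℕ) (tabs' : ∀ m : ℕ, SymTables 3 (Lc ^ m)) (cΛ cB : ℕ → ℝ) (m : ℕ)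
    {r : Fin 4 → ℕ} (hr : r ∈ box (3 + 1) (Lc ^ m)) :
    TshotOf Lc (JcOfTabs hLc N tabs' cΛ cB) m =
      hessKer (coDressKBmAt (toSite r) (Lc ^ m) (KInvStep (d := 3) (Lc ^ m) 0))
        (vertexOfK (coDressKBmAt (toSite r) (Lc ^ m) (KInvStep (d := 3) (Lc ^ m) 0)) (Lc ^ m) (JcOfTabs hLc N tabs' cΛ cB m).S)
        (JcOfTabs hLc N tabs' cΛ cB m).W := by
  show TOf (N := Lc ^ m) (JcOfTabs hLc N tabs' cΛ cB m) = _
  rw [JcOfTabs_apply]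
  exact TOf_JsB12CombShSym_zero_eq_hessKer_bm (Lc ^ m) hLc.pow N (tabs' m) (cΛ m) (cB m) hr

end Summit.QuantumFields.BalabanUV.Beta.D1BFx.RoadJ1Absorption

end
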